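import Mathlib
import HarnessLib
import Literature.AlgebraicGeometry.Resolution.CobordantBlowupFiltration

/-!
# S1a — A5a support: DEGREE-ZERO SPANS — the pieces `𝒜 λ` and the degree-0 trace of a weighted filtration are spanned
# over `𝒜 0` by monomials in homogeneous generators

(crux stmt-ResolutionOfSingularities-15640 `WildQuotients.WildQuotientResolution`, line `Sketch`; S1 =
stmt-ResolutionOfSingularities-17941; S1a H3-scheme, res-L1-w45c-idea-2 H4a `h123/S1aCoarseChart.lean` e175f20bf932428b
(G1a) `VeroneseNormalisation`; res-L1-w45c-plan-1 ASSIGN 2026-08-27T21:22:26Z (A5a → res-D-pv-033). [OURS · L1 W4.5c] —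
NOT a statement of any manuscript; standard graded-ring bookkeeping; AI-produced, weaker than expert review. Def-free.
Prover res-D-pv-033.)

`B` graded by `𝒜 : ι → AddSubgroup B` (`ι` an additive commutative group), `v : Fin M → B` homogeneous of degrees `dv`
generating `B` over `𝒜 0` (`Algebra.adjoin (𝒜 0) (range v) = ⊤`). Monomials `v^γ = ∏ vᵢ^γᵢ` have degree
`deg γ = ∑ γᵢ • dvᵢ` (`prod_pow_mem_graded`).
* `decompose_aeval_mem_span` / **`mem_span_monomials_of_mem`** — every `x ∈ 𝒜 λ` is an `𝒜 0`-combination of the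
  monomials `v^γ` with `deg γ = λ`;
* **`mem_span_weighted_of_mem_trace`** — for a homogeneous centre `f : Fin c → B` (degrees `δ`) with weights `w`:
  every `x ∈ 𝒜 0 ∩ 𝒥_N` (`𝒥 = weightedFiltration f w`, [cite: Wlodarczyk2022, Lemma 2.1.9]) is an `𝒜 0`-combination
  of monomials `∏ uᵢ^θᵢ` in the joint family `u = (v, f)` with TOTAL DEGREE `0` and `f`-WEIGHT `≥ N`.
-/

-- single-problem summit: the doubled namespace component `ResolutionOfSingularities` is forced
set_option linter.dupNamespace false

noncomputable section

open DirectSum Literature.AlgebraicGeometry.Resolution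

namespace Summit.ResolutionOfSingularities.ResolutionOfSingularities.Theorems.WildQuotientResolution.S1.CoarseChart

universe u v

variable {ι : Type v} [AddCommGroup ι] [DecidableEq ι] {B : Type u} [CommRing B]
  (𝒜 : ι → AddSubgroup B) [GradedRing 𝒜]

/-! ## Monomials in homogeneous elements -/

/-- A monomial in homogeneous elements is homogeneous of the weighted degree. [folklore] -/
theorem prod_pow_mem_graded {M : ℕ} (v : Fin M → B) (dv : Fin M → ι) (hv : ∀ i, v i ∈ 𝒜 (dv i))
    (γ : Fin M → ℕ) : (∏ i, v i ^ γ i) ∈ 𝒜 (∑ i, γ i • dv i) :=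
  SetLike.prod_mem_graded 𝒜 (fun i => γ i • dv i) (fun i => v i ^ γ i) fun i _ =>
    SetLike.pow_mem_graded (γ i) (hv i)

/-- The degree-`λ` component of `a · m` for `a ∈ 𝒜 0`, `m ∈ 𝒜 μ`: `a m` if `μ = λ`, else `0`. [folklore] -/
theorem decompose_zero_mul_of_mem {a m : B} (ha : a ∈ 𝒜 0) {μ : ι} (hm : m ∈ 𝒜 μ) (lam : ι) :
    (decompose 𝒜 (a * m) lam : B) = if μ = lam then a * m else 0 := by
  have hmem : a * m ∈ 𝒜 μ := by
    have := SetLike.mul_mem_graded ha hm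
    rwa [zero_add] at this
  split_ifs with h
  · subst h; exact decompose_of_mem_same 𝒜 hmem
  · exact decompose_of_mem_ne 𝒜 hmem h

section Generators

variable {M : ℕ} (v : Fin M → B) (dv : Fin M → ι) (hv : ∀ i, v i ∈ 𝒜 (dv i))

include hv in
/-- The degree-`λ` component of a polynomial expression in the generators lies in the `𝒜 0`-span of the monomials
of degree `λ`. [folklore] -/
theorem decompose_aeval_mem_span (P : MvPolynomial (Fin M) ↥(𝒜 0)) (lam : ι) :
    (decompose 𝒜 (MvPolynomial.aeval v P) lam : B) ∈
      Submodule.span ↥(𝒜 0) {y : B | ∃ γ : Fin M → ℕ, ∑ i, γ i • dv i = lam ∧ y = ∏ i, v i ^ γ i} := by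
  rw [MvPolynomial.aeval_def, MvPolynomial.eval₂_eq', ← GradedRing.proj_apply, map_sum]
  refine Submodule.sum_mem _ fun d _ => ?_
  have hcoef : (algebraMap ↥(𝒜 0) B (MvPolynomial.coeff d P)) ∈ 𝒜 0 := (MvPolynomial.coeff d P).2
  rw [GradedRing.proj_apply, decompose_zero_mul_of_mem 𝒜 hcoef (prod_pow_mem_graded 𝒜 v dv hv (fun i => d i)) lam]
  split_ifs with h
  · rw [← Algebra.smul_def]
    exact Submodule.smul_mem _ _ (Submodule.subset_span ⟨fun i => d i, h, rfl⟩)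
  · exact Submodule.zero_mem _

include hv in
/-- **`𝒜 λ` is spanned over `𝒜 0` by the monomials of degree `λ`** in homogeneous generators of `B` over `𝒜 0`.
[folklore] -/
theorem mem_span_monomials_of_mem (hgen : Algebra.adjoin ↥(𝒜 0) (Set.range v) = ⊤) {lam : ι} {x : B}
    (hx : x ∈ 𝒜 lam) :
    x ∈ Submodule.span ↥(𝒜 0) {y : B | ∃ γ : Fin M → ℕ, ∑ i, γ i • dv i = lam ∧ y = ∏ i, v i ^ γ i} := by
  have hx' : x ∈ (MvPolynomial.aeval v : MvPolynomial (Fin M) ↥(𝒜 0) →ₐ[↥(𝒜 0)] B).range := by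
    rw [← Algebra.adjoin_range_eq_range_aeval, hgen]; exact Algebra.mem_top
  obtain ⟨P, rfl⟩ := hx'
  rw [← decompose_of_mem_same 𝒜 hx]
  exact decompose_aeval_mem_span 𝒜 v dv hv P lam

/-! ## The degree-0 trace of a weighted filtration -/

variable {c : ℕ} (f : Fin c → B) (δ : Fin c → ι) (hf : ∀ i, f i ∈ 𝒜 (δ i)) (w : Fin c → ℕ)

include hv hf in
/-- **The degree-0 trace is spanned by degree-0 monomials of large weight**: every `x ∈ 𝒜 0 ∩ 𝒥_N` is an
`𝒜 0`-combination of monomials `v^γ f^α` with `deg γ + deg α = 0` and `∑ αᵢ wᵢ ≥ N`. [folklore] -/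
theorem mem_span_weighted_of_mem_trace (hgen : Algebra.adjoin ↥(𝒜 0) (Set.range v) = ⊤) (N : ℕ) {x : B}
    (hx0 : x ∈ 𝒜 0) (hxN : x ∈ (weightedFiltration f w).ideal N) :
    x ∈ Submodule.span ↥(𝒜 0) {y : B | ∃ (γ : Fin M → ℕ) (α : Fin c → ℕ),
      (∑ i, γ i • dv i) + (∑ i, α i • δ i) = 0 ∧ N ≤ ∑ i, α i * w i ∧
      y = (∏ i, v i ^ γ i) * ∏ i, f i ^ α i} := by
  rw [weightedFiltration_ideal] at hxN
  -- `x = Σ b_j m_j` with weighted monomials `m_j`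
  obtain ⟨n, b, m, hsum⟩ := Submodule.mem_span_set'.mp hxN
  rw [← decompose_of_mem_same 𝒜 hx0, ← hsum, ← GradedRing.proj_apply, map_sum]
  refine Submodule.sum_mem _ fun j _ => ?_
  rw [GradedRing.proj_apply]
  obtain ⟨α, hαN, hαm⟩ := (m j).2
  -- the monomial `m_j = f^α` as a product over `Fin c`, its degree and weight
  have hmono : ((m j : B)) = ∏ i, f i ^ α i := by
    rw [← hαm, Finsupp.prod_fintype _ _ fun i => pow_zero _]
  have hwt : Finsupp.weight w α = ∑ i, α i * w i := by
    rw [Finsupp.weight_apply, Finsupp.sum_fintype _ _ fun i => by simp]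
    simp [smul_eq_mul]
  have hmem : ((m j : B)) ∈ 𝒜 (∑ i, α i • δ i) := by
    rw [hmono]; exact prod_pow_mem_graded 𝒜 f δ hf fun i => α i
  -- degree-0 part of `b_j • m_j` = (degree `-deg α` part of `b_j`) · `m_j`
  have key := coe_decompose_mul_add_of_right_mem 𝒜 (a := b j) (i := -∑ i, α i • δ i) hmem
  rw [neg_add_cancel] at key
  rw [smul_eq_mul, key]
  -- expand the degree `-deg α` part of `b_j` in monomials of `v`
  have hb := mem_span_monomials_of_mem 𝒜 v dv hv hgen (SetLike.coe_mem (decompose 𝒜 (b j) (-∑ i, α i • δ i)))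
  -- multiply the span by `m_j`
  have hmul : (decompose 𝒜 (b j) (-∑ i, α i • δ i) : B) * (m j : B) ∈
      Submodule.map (LinearMap.mulRight ↥(𝒜 0) ((m j : B)))
        (Submodule.span ↥(𝒜 0) {y : B | ∃ γ : Fin M → ℕ, ∑ i, γ i • dv i = -∑ i, α i • δ i ∧
          y = ∏ i, v i ^ γ i}) :=
    Submodule.mem_map_of_mem hb
  rw [Submodule.map_span] at hmul
  refine Submodule.span_mono ?_ hmul
  rintro _ ⟨y, ⟨γ, hγ, rfl⟩, rfl⟩
  refine ⟨γ, fun i => α i, ?_, ?_, ?_⟩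
  · rw [hγ, neg_add_cancel]
  · rw [← hwt]; exact hαN
  · rw [LinearMap.mulRight_apply, hmono]

end Generators

end Summit.ResolutionOfSingularities.ResolutionOfSingularities.Theorems.WildQuotientResolution.S1.CoarseChart

end
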